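import Mathlib
import Summits.CriticalPhenomena.CardyFormulaZ2.Theorems.CardySelfRefinementDefs
import Summits.CriticalPhenomena.CardyFormulaZ2.Theorems.CardySelfRefinementGradientComparabilityStubCornerWindowsDefect
import Summits.CriticalPhenomena.CardyFormulaZ2.Theorems.CardySelfRefinementGradientComparabilityStubCornerWindowsDefectBoundary
import Summits.CriticalPhenomena.CardyFormulaZ2.Theorems.CardySelfRefinementGradientComparabilityStubCornerWindowsDefectBoundaryRho1
import Summits.CriticalPhenomena.CardyFormulaZ2.Theorems.CardySelfRefinementGradientComparabilityStubCornerWindowsDcBound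
import Summits.CriticalPhenomena.CardyFormulaZ2.Theorems.CardySelfRefinementGradientComparabilityStubSlopeBoundsCornerConfinement
import HarnessLib

/-!
# Crux `GradientComparability` (stmt-CriticalPhenomena-10269), line `monotone-product-coordinates` —
# support for stub `stub_cornerWindows`, part 8: the global reduction of the stub to its irreducible inputs

Route `CardySelfRefinement`, sub-problem `CriticalPhenomena/CardyFormulaZ2`; vocabulary from
`CardySelfRefinementDefs` (`ax tb M Aloc P Dc Dρ window coinWindow edgeOf`).  This file composes the
landed reductions of parts 3, 5, 6, 7 and of `…StubSlopeBoundsCornerConfinement` into ONE theorem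
(`stub_cornerWindows_of_inputs`) whose hypotheses are the true residue of `stub_cornerWindows` and
whose conclusion is the stub verbatim; its two halves (one per slice) are the registered statements.

## Mathematics

`stub_cornerWindows = h0 ∧ h1`: on the slices `{c = 0}` (h0) and `{ρ = 1}` (h1) of the parameter square,
every point of the level band `{P_η ∈ [vlo, vhi]}` has `|∂ρP|` comparable, both ways and with one
mesh-uniform constant, with `|∂ρP(1,0)|` at the tied corner.  By the exact pattern identity of part 3,
`∂ρP = ½ N − 2^{-k} T` (`N` = bundle-pivotal mass of the window, `T` = the section-defect double sum),
each window follows from a Kesten-type stability of `N` across the band and a defect bound `T ≤ θ 2^k N`,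
`θ < ½` (`cornerWindow_c0/rho1_of_pivotalWindow_of_defectBound : (K0) → (D0) → h0`, `(K1) → (D1) → h1`).
Parts 5–7 reduce the defect bounds to boundary-layer counts and to the two corner inputs of the line:

* `{c = 0}`: `(D0) ⟸ (D0∂) ⟸ (D0π)` (`defectBound_c0_of_boundaryDefectBound`,
  `boundaryDefectBound_c0_of_boundaryPivotalBound`): the far proper defect vanishes exactly on this
  slice (brick S2), so only the pivotal mass of the `2η`-boundary layer has to stay below `θ″ N`, `θ″ < ½`;
* `{ρ = 1}`: `(D1) ⟸ (D1∂) + (D1o)` (`defectBound_rho1_of_boundaryDefectBound_of_farDefectSmall`),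
  `(D1o) ⟸ (D1c) + (D1∇)` (`farDefectSmall_rho1_of_cRange_of_DcBound`),
  `(D1c) ⟸ (CONF) ⟸ (HWB)` (`cRange_rho1_of_cornerConfinement`, `cornerConfinement_of_hardWayBoxes`),
  `(D1∇) ⟸ (LOC) + (D1c)` (`DcBound_rho1_of_cornerLocalSlope_of_cRange`, part 7).

Hence `stub_cornerWindows ⟸ (K0) ∧ (K1) ∧ (D0π) ∧ (D1∂) ∧ (LOC) ∧ (HWB)`: two Kesten windows for the
bundle-pivotal mass (K0 on `{c = 0}`, K1 on `{ρ = 1}`), two boundary-layer counts (D0π, D1∂), and the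
two registered corner stubs of the line, `stub_cornerLocalSlope` (LOC) and `stub_cornerHardWayBoxes`
(HWB), taken verbatim as hypotheses.  Pure composition; no percolation estimate and no named fact is
used here.
-/

noncomputable section

namespace Summit.CriticalPhenomena.CardyFormulaZ2.Theorems.CardySelfRefinement

open scoped Topology
open Filter Set MeasureTheory
open Literature.Probability.LatticeModels Literature.Probability.Percolation
open Literature.Probability.Percolation.QuadCrossing
open Summit.CriticalPhenomena.CardyFormulaZ2.Theses.CardySelfRefinement

/-- **Residue of the window on the slice `{c = 0}`** (registered, wave 6): `(K0) → (D0π) → h0` — the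
Kesten window (K0) for the bundle-pivotal mass and the boundary-layer pivotal count (D0π) (the `2η`-layer
carries less than half of the pivotal mass, band points and corner) give the first clause `h0` of
`stub_cornerWindows`.  Composition of `cornerWindow_c0_of_pivotalWindow_of_defectBound` (part 3) with
`defectBound_c0_of_boundaryDefectBound ∘ boundaryDefectBound_c0_of_boundaryPivotalBound` (part 5). -/
theorem stub_cornerWindows_c0_of_inputs : (∀ k : ℕ, k = 2 ∨ k = 3 → ∀ (m : ℕ) (F : Fin m → Quad (Set.univ : Set ℂ)), 0 < m → ∀ vlo vhi : ℝ, 0 < vlo → vlo < vhi → vhi < 1 → ∃ C η₁ : ℝ, 0 < η₁ ∧ ∀ η ∈ Set.Ioo 0 η₁, ∀ K : Finset (Site 2 × Fin 2 × Fin 3), (↑K : Set (Site 2 × Fin 2 × Fin 3)) = coinWindow k (window m F η) → ∀ ρ ∈ Set.Icc (0 : ℝ) 1, P k m F η ρ 0 ∈ Set.Icc vlo vhi → ∑ i ∈ K with i.2.2 = 2, (M k ρ 0).real {ω | ω ∪ edgeOf '' {vd : Site 2 × Fin 2 | ax k vd ∧ tb k vd = i.1 ∧ vd.2 = i.2.1}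 ∈ Aloc m F η ∧ ω \ edgeOf '' {vd : Site 2 × Fin 2 | ax k vd ∧ tb k vd = i.1 ∧ vd.2 = i.2.1} ∉ Aloc m F η} ≤ C * ∑ i ∈ K with i.2.2 = 2, (M k 1 0).real {ω | ω ∪ edgeOf '' {vd : Site 2 × Fin 2 | ax k vd ∧ tb k vd = i.1 ∧ vd.2 = i.2.1} ∈ Aloc m F η ∧ ω \ edgeOf '' {vd : Site 2 × Fin 2 | ax k vd ∧ tb k vd = i.1 ∧ vd.2 = i.2.1} ∉ Aloc m F η} ∧ ∑ i ∈ K with i.2.2 = 2, (M k 1 0).real {ω | ω ∪ edgeOf '' {vd : Site 2 × Fin 2 | ax k vd ∧ tb k vd = i.1 ∧ vd.2 = i.2.1} ∈ Aloc m F η ∧ ω \ edgeOf '' {vd : Site 2 × Fin 2 | ax k vd ∧ tb k vd = i.1 ∧ vd.2 = i.2.1} ∉ Aloc m F η} ≤ C * ∑ i ∈ K with i.2.2 = 2, (M k ρ 0).real {ω | ω ∪ edgeOf '' {vd : Site 2 × Fin 2 | ax k vd ∧ tb k vd = i.1 ∧ vd.2 = i.2.1} ∈ Aloc m F η ∧ ω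 \ edgeOf '' {vd : Site 2 × Fin 2 | ax k vd ∧ tb k vd = i.1 ∧ vd.2 = i.2.1} ∉ Aloc m F η}) → (∀ k : ℕ, k = 2 ∨ k = 3 → ∀ (m : ℕ) (F : Fin m → Quad (Set.univ : Set ℂ)), 0 < m → ∀ vlo vhi : ℝ, 0 < vlo → vlo < vhi → vhi < 1 → ∃ θ η₁ : ℝ, θ < 1 / 2 ∧ 0 < η₁ ∧ ∀ η ∈ Set.Ioo 0 η₁, ∀ K : Finset (Site 2 × Fin 2 × Fin 3), (↑K : Set (Site 2 × Fin 2 × Fin 3)) = coinWindow k (window m F η) → ∀ S : Finset (Site 2 × Fin 2 × Fin 3), S ⊆ K.filter (fun i => i.2.2 = 2) → (∀ i ∈ S, ∃ j : ℕ, j ≤ k ∧ ∃ (a : Fin m) (b : Fin 4), ∃ q ∈ (F a).side b, dist ((η : ℂ) * squareLatticeEmbedding.z (fun l => (k : ℤ) * i.1 l + if l = i.2.1 then (j : ℤ) else 0)) q < 2 * η) → (∀ ρ ∈ Set.Icc (0 : ℝ) 1, P k m F η ρ 0 ∈ Set.Icc vlo vhi → ∑ i ∈ S, (M k ρ 0).real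 {ω | ω ∪ edgeOf '' {vd : Site 2 × Fin 2 | ax k vd ∧ tb k vd = i.1 ∧ vd.2 = i.2.1} ∈ Aloc m F η ∧ ω \ edgeOf '' {vd : Site 2 × Fin 2 | ax k vd ∧ tb k vd = i.1 ∧ vd.2 = i.2.1} ∉ Aloc m F η} ≤ θ * ∑ i ∈ K with i.2.2 = 2, (M k ρ 0).real {ω | ω ∪ edgeOf '' {vd : Site 2 × Fin 2 | ax k vd ∧ tb k vd = i.1 ∧ vd.2 = i.2.1} ∈ Aloc m F η ∧ ω \ edgeOf '' {vd : Site 2 × Fin 2 | ax k vd ∧ tb k vd = i.1 ∧ vd.2 = i.2.1} ∉ Aloc m F η}) ∧ ∑ i ∈ S, (M k 1 0).real {ω | ω ∪ edgeOf '' {vd : Site 2 × Fin 2 | ax k vd ∧ tb k vd = i.1 ∧ vd.2 = i.2.1} ∈ Aloc m F η ∧ ω \ edgeOf '' {vd : Site 2 × Fin 2 | ax k vd ∧ tb k vd = i.1 ∧ vd.2 = i.2.1} ∉ Aloc m F η} ≤ θ * ∑ i ∈ K with i.2.2 = 2, (M k 1 0).real {ω | ω ∪ edgeOf '' {vd : Site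 2 × Fin 2 | ax k vd ∧ tb k vd = i.1 ∧ vd.2 = i.2.1} ∈ Aloc m F η ∧ ω \ edgeOf '' {vd : Site 2 × Fin 2 | ax k vd ∧ tb k vd = i.1 ∧ vd.2 = i.2.1} ∉ Aloc m F η}) → ∀ k : ℕ, k = 2 ∨ k = 3 → ∀ (m : ℕ) (F : Fin m → Quad (Set.univ : Set ℂ)), 0 < m → ∀ vlo vhi : ℝ, 0 < vlo → vlo < vhi → vhi < 1 → ∃ C η₁ : ℝ, 0 < η₁ ∧ ∀ η ∈ Set.Ioo 0 η₁, ∀ ρ ∈ Set.Icc (0 : ℝ) 1, P k m F η ρ 0 ∈ Set.Icc vlo vhi → |Dρ k m F η (ρ, 0)| ≤ C * |Dρ k m F η (1, 0)| ∧ |Dρ k m F η (1, 0)| ≤ C * |Dρ k m F η (ρ, 0)| :=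
  fun hK0 hD0 => cornerWindow_c0_of_pivotalWindow_of_defectBound hK0
    (defectBound_c0_of_boundaryDefectBound (boundaryDefectBound_c0_of_boundaryPivotalBound hD0))

/-- **Residue of the window on the slice `{ρ = 1}`** (registered, wave 6):
`(K1) → (D1∂) → (LOC) → (HWB) → h1` — the Kesten window (K1) for the bundle-pivotal mass on the
enhancement slice, the boundary-layer proper-defect count (D1∂), and the two registered corner stubs of
the line, `stub_cornerLocalSlope` (LOC) and `stub_cornerHardWayBoxes` (HWB), taken verbatim as
hypotheses, give the second clause `h1` of `stub_cornerWindows`.  Composition of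
`cornerWindow_rho1_of_pivotalWindow_of_defectBound` (part 3) with
`defectBound_rho1_of_boundaryDefectBound_of_farDefectSmall`, `farDefectSmall_rho1_of_cRange_of_DcBound`,
`cRange_rho1_of_cornerConfinement` (part 6), `cornerConfinement_of_hardWayBoxes` and
`DcBound_rho1_of_cornerLocalSlope_of_cRange` (part 7). -/
theorem stub_cornerWindows_rho1_of_inputs : (∀ k : ℕ, k = 2 ∨ k = 3 → ∀ (m : ℕ) (F : Fin m → Quad (Set.univ : Set ℂ)), 0 < m → ∀ vlo vhi : ℝ, 0 < vlo → vlo < vhi → vhi < 1 → ∃ C η₁ : ℝ, 0 < η₁ ∧ ∀ η ∈ Set.Ioo 0 η₁, ∀ K : Finset (Site 2 × Fin 2 × Fin 3), (↑K : Set (Site 2 × Fin 2 × Fin 3)) = coinWindow k (window m F η) → ∀ c ∈ Set.Icc (0 : ℝ) 1, P k m F η 1 c ∈ Set.Icc vlo vhi → ∑ i ∈ K with i.2.2 = 2, (M k 1 c).real {ω | ω ∪ edgeOf '' {vd : Site 2 × Fin 2 | ax k vd ∧ tb k vd = i.1 ∧ vd.2 = i.2.1} ∈ Aloc m F η ∧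 ω \ edgeOf '' {vd : Site 2 × Fin 2 | ax k vd ∧ tb k vd = i.1 ∧ vd.2 = i.2.1} ∉ Aloc m F η} ≤ C * ∑ i ∈ K with i.2.2 = 2, (M k 1 0).real {ω | ω ∪ edgeOf '' {vd : Site 2 × Fin 2 | ax k vd ∧ tb k vd = i.1 ∧ vd.2 = i.2.1} ∈ Aloc m F η ∧ ω \ edgeOf '' {vd : Site 2 × Fin 2 | ax k vd ∧ tb k vd = i.1 ∧ vd.2 = i.2.1} ∉ Aloc m F η} ∧ ∑ i ∈ K with i.2.2 = 2, (M k 1 0).real {ω | ω ∪ edgeOf '' {vd : Site 2 × Fin 2 | ax k vd ∧ tb k vd = i.1 ∧ vd.2 = i.2.1} ∈ Aloc m F η ∧ ω \ edgeOf '' {vd : Site 2 × Fin 2 | ax k vd ∧ tb k vd = i.1 ∧ vd.2 = i.2.1} ∉ Aloc m F η} ≤ C * ∑ i ∈ K with i.2.2 = 2, (M k 1 c).real {ω | ω ∪ edgeOf '' {vd : Site 2 × Fin 2 | ax k vd ∧ tb k vd = i.1 ∧ vd.2 = i.2.1} ∈ Aloc m F η ∧ ω \ edgeOf '' {vd : Site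 2 × Fin 2 | ax k vd ∧ tb k vd = i.1 ∧ vd.2 = i.2.1} ∉ Aloc m F η}) → (∀ k : ℕ, k = 2 ∨ k = 3 → ∀ (m : ℕ) (F : Fin m → Quad (Set.univ : Set ℂ)), 0 < m → ∀ vlo vhi : ℝ, 0 < vlo → vlo < vhi → vhi < 1 → ∃ θ η₁ : ℝ, θ < 1 / 2 - (1 / 2) ^ k ∧ 0 < η₁ ∧ ∀ η ∈ Set.Ioo 0 η₁, ∀ K : Finset (Site 2 × Fin 2 × Fin 3), (↑K : Set (Site 2 × Fin 2 × Fin 3)) = coinWindow k (window m F η) → ∀ S ⊆ K.filter (·.2.2 = 2), (∀ i ∈ S, ∃ j, j ≤ k ∧ ∃ a b, ∃ q ∈ (F a).side b, dist ((η : ℂ) * squareLatticeEmbedding.z (fun l => (k : ℤ) * i.1 l + if l = i.2.1 then (j : ℤ) else 0)) q < 2 * η) → ∀ c ∈ Set.Icc (0 : ℝ) 1, c = 0 ∨ P k m F η 1 c ∈ Set.Icc vlo vhi → (1 / 2) ^ k * ∑ i ∈ S, ∑ J ∈ (Finset.range k).powerset.erase (Finset.range k), (M k 1 c).real ({ω |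 ω \ edgeOf '' {vd | ax k vd ∧ tb k vd = i.1 ∧ vd.2 = i.2.1} ∪ ↑(J.image fun j : ℕ => edgeOf ((fun l => (k : ℤ) * i.1 l + if l = i.2.1 then (j : ℤ) else 0), i.2.1)) ∈ Aloc m F η} \ {ω | ω \ edgeOf '' {vd | ax k vd ∧ tb k vd = i.1 ∧ vd.2 = i.2.1} ∈ Aloc m F η}) ≤ θ * ∑ i ∈ K with i.2.2 = 2, (M k 1 c).real {ω | ω ∪ edgeOf '' {vd | ax k vd ∧ tb k vd = i.1 ∧ vd.2 = i.2.1} ∈ Aloc m F η ∧ ω \ edgeOf '' {vd | ax k vd ∧ tb k vd = i.1 ∧ vd.2 = i.2.1} ∉ Aloc m F η}) → (∀ k : ℕ, k = 2 ∨ k = 3 → ∀ (m : ℕ) (F : Fin m → Quad (Set.univ : Set ℂ)), 0 < m → ∃ δ c₀ : ℝ, 0 < δ ∧ 0 < c₀ ∧ ∀ vlo vhi : ℝ, 0 < vlo → vlo < vhi → vhi < 1 → ∃ C η₁ : ℝ, 0 < η₁ ∧ ∀ η ∈ Set.Ioo 0 η₁, ∀ ρ ∈ Set.Icc (1 - 2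 * δ) 1, ∀ c ∈ Set.Icc (0 : ℝ) c₀, P k m F η ρ c ∈ Set.Icc vlo vhi → |Dc k m F η (ρ, c)| ≤ C * |Dρ k m F η (ρ, c)|) → (∀ k : ℕ, k = 2 ∨ k = 3 → ∀ c₀ : ℝ, 0 < c₀ → ∃ δ : ℝ, 0 < δ ∧ ∀ ε : ℝ, 0 < ε → ∃ n₀ : ℕ, ∀ n : ℕ, n₀ ≤ n → ∀ w : ℂ, ∀ ρ ∈ Set.Icc (1 - 2 * δ) 1, 1 - ε ≤ (M k ρ c₀).real (embRectCrossing (fun v => squareLatticeEmbedding.z v - w) (8 * n) n) ∧ 1 - ε ≤ (M k ρ c₀).real (embTBCrossing (fun v => squareLatticeEmbedding.z v - w) n (8 * n))) → ∀ k : ℕ, k = 2 ∨ k = 3 → ∀ (m : ℕ) (F : Fin m → Quad (Set.univ : Set ℂ)), 0 < m → ∀ vlo vhi : ℝ, 0 < vlo → vlo < vhi → vhi < 1 → ∃ C η₁ : ℝ, 0 < η₁ ∧ ∀ η ∈ Set.Ioo 0 η₁, ∀ c ∈ Set.Icc (0 : ℝ) 1, P k m F η 1 c ∈ Set.Icc vlo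 vhi → |Dρ k m F η (1, c)| ≤ C * |Dρ k m F η (1, 0)| ∧ |Dρ k m F η (1, 0)| ≤ C * |Dρ k m F η (1, c)| :=
  fun hK1 hD1 hL hH => cornerWindow_rho1_of_pivotalWindow_of_defectBound hK1
    (defectBound_rho1_of_boundaryDefectBound_of_farDefectSmall hD1
      (farDefectSmall_rho1_of_cRange_of_DcBound
        (cRange_rho1_of_cornerConfinement (cornerConfinement_of_hardWayBoxes hH))
        (DcBound_rho1_of_cornerLocalSlope_of_cRange hL
          (cRange_rho1_of_cornerConfinement (cornerConfinement_of_hardWayBoxes hH)))))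

/-- **Global reduction of `stub_cornerWindows`** (wave 6):
`(K0) → (K1) → (D0π) → (D1∂) → (LOC) → (HWB) → stub_cornerWindows`, where (K0)/(K1) are the Kesten
windows for the bundle-pivotal mass on the slices `{c = 0}`/`{ρ = 1}` (first hypotheses of
`cornerWindow_c0/rho1_of_pivotalWindow_of_defectBound`), (D0π)/(D1∂) the boundary-layer counts of
`boundaryDefectBound_c0_of_boundaryPivotalBound` / `defectBound_rho1_of_boundaryDefectBound_of_farDefectSmall`,
and (LOC) = `stub_cornerLocalSlope`, (HWB) = `stub_cornerHardWayBoxes` verbatim; the conclusion is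
`stub_cornerWindows` verbatim.  It is the pair of the two registered halves
`stub_cornerWindows_c0_of_inputs`, `stub_cornerWindows_rho1_of_inputs` (its own one-line signature,
6489 characters, exceeds the registry bound of 4000, so the halves carry the registration). -/
theorem stub_cornerWindows_of_inputs : (∀ k : ℕ, k = 2 ∨ k = 3 → ∀ (m : ℕ) (F : Fin m → Quad (Set.univ : Set ℂ)), 0 < m → ∀ vlo vhi : ℝ, 0 < vlo → vlo < vhi → vhi < 1 → ∃ C η₁ : ℝ, 0 < η₁ ∧ ∀ η ∈ Set.Ioo 0 η₁, ∀ K : Finset (Site 2 × Fin 2 × Fin 3), (↑K : Set (Site 2 × Fin 2 × Fin 3)) = coinWindow k (window m F η) → ∀ ρ ∈ Set.Icc (0 : ℝ) 1, P k m F η ρ 0 ∈ Set.Icc vlo vhi → ∑ i ∈ K with i.2.2 = 2, (M k ρ 0).real {ω | ω ∪ edgeOf '' {vd : Site 2 × Fin 2 | ax k vd ∧ tb k vd = i.1 ∧ vd.2 = i.2.1} ∈ Aloc m F η ∧ ω \ edgeOf '' {vd : Site 2 × Fin 2 | ax k vd ∧ tb k vd = i.1 ∧ vd.2 = i.2.1}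 ∉ Aloc m F η} ≤ C * ∑ i ∈ K with i.2.2 = 2, (M k 1 0).real {ω | ω ∪ edgeOf '' {vd : Site 2 × Fin 2 | ax k vd ∧ tb k vd = i.1 ∧ vd.2 = i.2.1} ∈ Aloc m F η ∧ ω \ edgeOf '' {vd : Site 2 × Fin 2 | ax k vd ∧ tb k vd = i.1 ∧ vd.2 = i.2.1} ∉ Aloc m F η} ∧ ∑ i ∈ K with i.2.2 = 2, (M k 1 0).real {ω | ω ∪ edgeOf '' {vd : Site 2 × Fin 2 | ax k vd ∧ tb k vd = i.1 ∧ vd.2 = i.2.1} ∈ Aloc m F η ∧ ω \ edgeOf '' {vd : Site 2 × Fin 2 | ax k vd ∧ tb k vd = i.1 ∧ vd.2 = i.2.1} ∉ Aloc m F η} ≤ C * ∑ i ∈ K with i.2.2 = 2, (M k ρ 0).real {ω | ω ∪ edgeOf '' {vd : Site 2 × Fin 2 | ax k vd ∧ tb k vd = i.1 ∧ vd.2 = i.2.1} ∈ Aloc m F η ∧ ω \ edgeOf '' {vd : Site 2 × Fin 2 | ax k vd ∧ tb k vd = i.1 ∧ vd.2 = i.2.1} ∉ Aloc m F η}) → (∀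 k : ℕ, k = 2 ∨ k = 3 → ∀ (m : ℕ) (F : Fin m → Quad (Set.univ : Set ℂ)), 0 < m → ∀ vlo vhi : ℝ, 0 < vlo → vlo < vhi → vhi < 1 → ∃ C η₁ : ℝ, 0 < η₁ ∧ ∀ η ∈ Set.Ioo 0 η₁, ∀ K : Finset (Site 2 × Fin 2 × Fin 3), (↑K : Set (Site 2 × Fin 2 × Fin 3)) = coinWindow k (window m F η) → ∀ c ∈ Set.Icc (0 : ℝ) 1, P k m F η 1 c ∈ Set.Icc vlo vhi → ∑ i ∈ K with i.2.2 = 2, (M k 1 c).real {ω | ω ∪ edgeOf '' {vd : Site 2 × Fin 2 | ax k vd ∧ tb k vd = i.1 ∧ vd.2 = i.2.1} ∈ Aloc m F η ∧ ω \ edgeOf '' {vd : Site 2 × Fin 2 | ax k vd ∧ tb k vd = i.1 ∧ vd.2 = i.2.1} ∉ Aloc m F η} ≤ C * ∑ i ∈ K with i.2.2 = 2, (M k 1 0).real {ω | ω ∪ edgeOf '' {vd : Site 2 × Fin 2 | ax k vd ∧ tb k vd = i.1 ∧ vd.2 = i.2.1} ∈ Aloc m F η ∧ ω \ edgeOf ''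 {vd : Site 2 × Fin 2 | ax k vd ∧ tb k vd = i.1 ∧ vd.2 = i.2.1} ∉ Aloc m F η} ∧ ∑ i ∈ K with i.2.2 = 2, (M k 1 0).real {ω | ω ∪ edgeOf '' {vd : Site 2 × Fin 2 | ax k vd ∧ tb k vd = i.1 ∧ vd.2 = i.2.1} ∈ Aloc m F η ∧ ω \ edgeOf '' {vd : Site 2 × Fin 2 | ax k vd ∧ tb k vd = i.1 ∧ vd.2 = i.2.1} ∉ Aloc m F η} ≤ C * ∑ i ∈ K with i.2.2 = 2, (M k 1 c).real {ω | ω ∪ edgeOf '' {vd : Site 2 × Fin 2 | ax k vd ∧ tb k vd = i.1 ∧ vd.2 = i.2.1} ∈ Aloc m F η ∧ ω \ edgeOf '' {vd : Site 2 × Fin 2 | ax k vd ∧ tb k vd = i.1 ∧ vd.2 = i.2.1} ∉ Aloc m F η}) → (∀ k : ℕ, k = 2 ∨ k = 3 → ∀ (m : ℕ) (F : Fin m → Quad (Set.univ : Set ℂ)), 0 < m → ∀ vlo vhi : ℝ, 0 < vlo → vlo < vhi → vhi < 1 → ∃ θ η₁ : ℝ, θ < 1 / 2 ∧ 0 < η₁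 ∧ ∀ η ∈ Set.Ioo 0 η₁, ∀ K : Finset (Site 2 × Fin 2 × Fin 3), (↑K : Set (Site 2 × Fin 2 × Fin 3)) = coinWindow k (window m F η) → ∀ S : Finset (Site 2 × Fin 2 × Fin 3), S ⊆ K.filter (fun i => i.2.2 = 2) → (∀ i ∈ S, ∃ j : ℕ, j ≤ k ∧ ∃ (a : Fin m) (b : Fin 4), ∃ q ∈ (F a).side b, dist ((η : ℂ) * squareLatticeEmbedding.z (fun l => (k : ℤ) * i.1 l + if l = i.2.1 then (j : ℤ) else 0)) q < 2 * η) → (∀ ρ ∈ Set.Icc (0 : ℝ) 1, P k m F η ρ 0 ∈ Set.Icc vlo vhi → ∑ i ∈ S, (M k ρ 0).real {ω | ω ∪ edgeOf '' {vd : Site 2 × Fin 2 | ax k vd ∧ tb k vd = i.1 ∧ vd.2 = i.2.1} ∈ Aloc m F η ∧ ω \ edgeOf '' {vd : Site 2 × Fin 2 | ax k vd ∧ tb k vd = i.1 ∧ vd.2 = i.2.1} ∉ Aloc m F η} ≤ θ * ∑ i ∈ K with i.2.2 = 2, (M k ρ 0).real {ω | ω ∪ edgeOf '' {vd : Site 2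 × Fin 2 | ax k vd ∧ tb k vd = i.1 ∧ vd.2 = i.2.1} ∈ Aloc m F η ∧ ω \ edgeOf '' {vd : Site 2 × Fin 2 | ax k vd ∧ tb k vd = i.1 ∧ vd.2 = i.2.1} ∉ Aloc m F η}) ∧ ∑ i ∈ S, (M k 1 0).real {ω | ω ∪ edgeOf '' {vd : Site 2 × Fin 2 | ax k vd ∧ tb k vd = i.1 ∧ vd.2 = i.2.1} ∈ Aloc m F η ∧ ω \ edgeOf '' {vd : Site 2 × Fin 2 | ax k vd ∧ tb k vd = i.1 ∧ vd.2 = i.2.1} ∉ Aloc m F η} ≤ θ * ∑ i ∈ K with i.2.2 = 2, (M k 1 0).real {ω | ω ∪ edgeOf '' {vd : Site 2 × Fin 2 | ax k vd ∧ tb k vd = i.1 ∧ vd.2 = i.2.1} ∈ Aloc m F η ∧ ω \ edgeOf '' {vd : Site 2 × Fin 2 | ax k vd ∧ tb k vd = i.1 ∧ vd.2 = i.2.1} ∉ Aloc m F η}) → (∀ k : ℕ, k = 2 ∨ k = 3 → ∀ (m : ℕ) (F : Fin m → Quad (Set.univ : Set ℂ)), 0 < m → ∀ vlo vhi : ℝ,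 0 < vlo → vlo < vhi → vhi < 1 → ∃ θ η₁ : ℝ, θ < 1 / 2 - (1 / 2) ^ k ∧ 0 < η₁ ∧ ∀ η ∈ Set.Ioo 0 η₁, ∀ K : Finset (Site 2 × Fin 2 × Fin 3), (↑K : Set (Site 2 × Fin 2 × Fin 3)) = coinWindow k (window m F η) → ∀ S ⊆ K.filter (·.2.2 = 2), (∀ i ∈ S, ∃ j, j ≤ k ∧ ∃ a b, ∃ q ∈ (F a).side b, dist ((η : ℂ) * squareLatticeEmbedding.z (fun l => (k : ℤ) * i.1 l + if l = i.2.1 then (j : ℤ) else 0)) q < 2 * η) → ∀ c ∈ Set.Icc (0 : ℝ) 1, c = 0 ∨ P k m F η 1 c ∈ Set.Icc vlo vhi → (1 / 2) ^ k * ∑ i ∈ S, ∑ J ∈ (Finset.range k).powerset.erase (Finset.range k), (M k 1 c).real ({ω | ω \ edgeOf '' {vd | ax k vd ∧ tb k vd = i.1 ∧ vd.2 = i.2.1} ∪ ↑(J.image fun j : ℕ => edgeOf ((fun l => (k : ℤ) * i.1 l + if l = i.2.1 then (j : ℤ) else 0), i.2.1)) ∈ Aloc m F η} \ {ω | ω \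 edgeOf '' {vd | ax k vd ∧ tb k vd = i.1 ∧ vd.2 = i.2.1} ∈ Aloc m F η}) ≤ θ * ∑ i ∈ K with i.2.2 = 2, (M k 1 c).real {ω | ω ∪ edgeOf '' {vd | ax k vd ∧ tb k vd = i.1 ∧ vd.2 = i.2.1} ∈ Aloc m F η ∧ ω \ edgeOf '' {vd | ax k vd ∧ tb k vd = i.1 ∧ vd.2 = i.2.1} ∉ Aloc m F η}) → (∀ k : ℕ, k = 2 ∨ k = 3 → ∀ (m : ℕ) (F : Fin m → Quad (Set.univ : Set ℂ)), 0 < m → ∃ δ c₀ : ℝ, 0 < δ ∧ 0 < c₀ ∧ ∀ vlo vhi : ℝ, 0 < vlo → vlo < vhi → vhi < 1 → ∃ C η₁ : ℝ, 0 < η₁ ∧ ∀ η ∈ Set.Ioo 0 η₁, ∀ ρ ∈ Set.Icc (1 - 2 * δ) 1, ∀ c ∈ Set.Icc (0 : ℝ) c₀, P k m F η ρ c ∈ Set.Icc vlo vhi → |Dc k m F η (ρ, c)| ≤ C * |Dρ k m F η (ρ, c)|) → (∀ k : ℕ, k = 2 ∨ k = 3 → ∀ c₀ : ℝ, 0 <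 c₀ → ∃ δ : ℝ, 0 < δ ∧ ∀ ε : ℝ, 0 < ε → ∃ n₀ : ℕ, ∀ n : ℕ, n₀ ≤ n → ∀ w : ℂ, ∀ ρ ∈ Set.Icc (1 - 2 * δ) 1, 1 - ε ≤ (M k ρ c₀).real (embRectCrossing (fun v => squareLatticeEmbedding.z v - w) (8 * n) n) ∧ 1 - ε ≤ (M k ρ c₀).real (embTBCrossing (fun v => squareLatticeEmbedding.z v - w) n (8 * n))) → (∀ k : ℕ, k = 2 ∨ k = 3 → ∀ (m : ℕ) (F : Fin m → Quad (Set.univ : Set ℂ)), 0 < m → ∀ vlo vhi : ℝ, 0 < vlo → vlo < vhi → vhi < 1 → ∃ C η₁ : ℝ, 0 < η₁ ∧ ∀ η ∈ Set.Ioo 0 η₁, ∀ ρ ∈ Set.Icc (0 : ℝ) 1, P k m F η ρ 0 ∈ Set.Icc vlo vhi → |Dρ k m F η (ρ, 0)| ≤ C * |Dρ k m F η (1, 0)| ∧ |Dρ k m F η (1, 0)| ≤ C * |Dρ k m F η (ρ, 0)|) ∧ (∀ k : ℕ, k = 2 ∨ k = 3 → ∀ (m : ℕ) (F : Fin m → Quad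 (Set.univ : Set ℂ)), 0 < m → ∀ vlo vhi : ℝ, 0 < vlo → vlo < vhi → vhi < 1 → ∃ C η₁ : ℝ, 0 < η₁ ∧ ∀ η ∈ Set.Ioo 0 η₁, ∀ c ∈ Set.Icc (0 : ℝ) 1, P k m F η 1 c ∈ Set.Icc vlo vhi → |Dρ k m F η (1, c)| ≤ C * |Dρ k m F η (1, 0)| ∧ |Dρ k m F η (1, 0)| ≤ C * |Dρ k m F η (1, c)|) :=
  fun hK0 hK1 hD0 hD1 hL hH =>
    ⟨stub_cornerWindows_c0_of_inputs hK0 hD0, stub_cornerWindows_rho1_of_inputs hK1 hD1 hL hH⟩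

end Summit.CriticalPhenomena.CardyFormulaZ2.Theorems.CardySelfRefinement

end
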